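import Literature.MathematicalPhysics.QuantumFieldTheory.Balaban1983to89.B6TranslateTorusV1L0
import Literature.MathematicalPhysics.QuantumFieldTheory.Balaban1983to89.B6Geom246MultiLevelTorusL0
import Literature.MathematicalPhysics.QuantumFieldTheory.Balaban1983to89.B6GlobalChartV1L0
import Literature.MathematicalPhysics.QuantumFieldTheory.Balaban1983to89.B6MultiLevelTorusOperatorL0
import Literature.MathematicalPhysics.QuantumFieldTheory.Balaban1983to89.B6Prop26ReachTransplantL0
import Literature.MathematicalPhysics.QuantumFieldTheory.Balaban1983to89.B6InMajorantTransplant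
/-!
# `Balaban1983to89.B6InMajorantTransplantL0` — LEVEL-0 TWIN (programme G-F3′-L0, director-ym LINE №27 / UV3-NODE §24.5; plan `lit-balaban-r03/G-F3L0-PLAN.md`) of `B6InMajorantTransplant`:
the same declarations, SAME NAMES AND STATEMENTS, for nested families WITH print's region `Λ₀ = T ∖ Ω₁` ADMITTED (structures
`B6MultiLevelBoxOperatorL0.Domains` / `B6MultiLevelTorusOperatorL0.TDomains`: levels `0, …, k`, the level-`0` block a single site, `Q′₀ = id`,
finite weight `a₀` — print p.225 (2.14) «Σ_{j=0}^k … (Q′₀λ)(x) = λ(x), x ∈ Λ₀», p.229 «taking a sequence (2.1) … smallest possible domains B^j(Λ_j),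
and considering the operator Δ_a defined by (2.19), (2.20) for this sequence»).  Every `D`-free object is the lineage's, consumed BY NAME; no existing
module is touched; no fact is minted.  Unit `lit-balaban-r03` (B6 fold owner, r03 gen 36); referee ref-4.  THE TWIN'S DOCUMENTATION FOLLOWS
VERBATIM (its «levels 1 … k» / «Ω₁ = X» sentences describe the twin; here `j` runs from `0` and `Ω₁` may be a proper subset).

# `Balaban1983to89.B6InMajorantTransplant` — T. Bałaban, *Propagators and renormalization transformations for lattice gauge theories. II*,
# Commun. Math. Phys. **96** (1984) 223–250 [Balaban1984PropagatorsII], (2.133)–(2.134) p. 247 with (2.91)–(2.93) p. 239: INPUT-LOCALISED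
# MAJORANTS («supp J ⊂ Δ(y′), y′ ∈ S», outputs ANYWHERE) — the notion, its transport through window charts and chart translations, and the
# UNIFORM BOUND of the transplanted two-scale `G_□` on the V1 torus for central inputs

statement-level skeleton of published theorems with citation tags; proofs where landed; nothing here is a claim about the Yang–Mills mass gap

PDF held: `paper:balaban1984-cmp96-propagators-rt-ii` (journal page = PDF page + 222): p. 239 [PDF 17] ((2.91)–(2.93): every term of `K_□′` carries `h_□′`
or `[Δ_a, h_□′]` on the left — INPUTS of `G_□′` are central, `supp h_□′ ⊂ □′`), p. 247 [PDF 25] ((2.133): *"for x ∈ Δ(y), supp J ⊂ Δ(y′), y, y′ ∈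
𝔅 ∩ T_□"*; (2.134)).

CITATION HEADER (lean-in-tree rule) — WHAT IS REPRODUCED.  Phase-2 file of the `lit-balaban` typed skeleton (HOME `run/shared/lean/pub/lit-balaban/`),
seat **r03 gen 20**; SKELETON rows **B6.Eq2.133** × **B6.Eq2.134** × B6.Prop2.6 (cells).  Owner's finding F4 (B6-CLOSURE §5 item 14): the (2.134)
consumer (`…B6Ineq2134KFamKLevelTorusL0.h2134_kFam_torus`) reads the member `G_□′` at ARBITRARY outputs but only with inputs supported in the central
reach `S_□′` (print's left factors `h_□′`, `[Δ_a, h_□′]` localise the outputs; the non-local `∂P∂*`-sandwich reads `G_□′h_□′` everywhere with its own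
decay), while a transplanted torus-window member has NO global-distance decay at wrap-around pairs.  THIS FILE supplies the input-localised language:
* §1 **`InMajorant blk T S K`** `:= ∀ y′ ∈ S, ∀ μ B, BlockSupp blk μ y′ B → ∀ x, |T μ x| ≤ K (blk x) y′ · B` (`LocalMajorant` without the output
  restriction; `HasMajorant` restricted to inputs over `S`): `inMajorant_of_hasMajorant`, `InMajorant.localMajorant`, `inMajorant_mono`,
  `inMajorant_smul`, `inMajorant_congr_set`;
* §2 **`inMajorant_transplant`** — the twin of `B6Prop26ReachTransplant.localMajorant_transplant` with the kernel comparison asked only for inputs over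
  `S` (outputs anywhere in the window; zero outside);
* §3 **`inMajorant_relabel`**, **`inMajorant_conj_chart`** — transport along a relabelling / the chart translation of `B6TranslateTorusV1`;
* §4 **`inMajorant_GlV1_bdd`** — THE UNIFORM BOUND: for the constants `A` of `B6Ineq2133TwoScaleV1.ineq2133_G` (on `d, L, a₀, a₁`), every member `t`,
  every V1 global torus (`hN`), window corner `x₀` (full member period inside the box, `L^j ∣ x₀`), half-period sub-window `[x₀, x₀ + Wd)` that is
  two-level, and every reach `S` whose bonds lie in the sub-window: `InMajorant (blkV1 hN D) (GlV1 t hN (cB t x₀ …).W x₀) S (fun _ _ ↦ L^{d+1}·A)`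
  — `|G_□ μ x| ≤ L^{d+1}A·B` for inputs over `S`, ALL outputs `x` (the member's (2.133) majorant with `e^{−δ d_{T_□}} ≤ 1`, `≤ L^{d+1}` charted
  `j`-blocks over a global block).
No new definition of mathematical content beyond `InMajorant`; no new fact; standard axioms.
HONEST SCOPE. Bookkeeping; the bound of §4 is uniform (no decay) — decay for far outputs is FALSE for window members (F4) and not needed by print;
decay on the central reach is `B6FullWindowReachV1L0.reach2133_G_V1_full`. NOT summit progress.  Unit `lit-balaban-r03` (gen 20), 2026-08-23.
-/

noncomputable section

open scoped BigOperators
open Finset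

namespace Literature.MathematicalPhysics.QuantumFieldTheory.Balaban1983to89.B6InMajorantTransplantL0

open B6RandomWalk (HasMajorant BlockSupp blockPiece sum_blockPiece blockSupp_blockPiece)
open B6Prop26Gluing (LocalMajorant)
open B6Prop26ReachTransplant (restrictOp transplant restrictOp_apply transplant_apply restrictOp_apply_of_injOn restrictOp_apply_of_not_mem)
open Literature.MathematicalPhysics.QuantumFieldTheory.Balaban1983to89.B6InMajorantTransplant (InMajorant inMajorant_of_hasMajorant InMajorant.localMajorant inMajorant_mono inMajorant_smul inMajorant_congr_set inMajorant_subset inMajorant_transplant inMajorant_relabel)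

/-! ## §1  Input-localised majorants -/

section Defs

variable {g : B6.Geometry} {X : Type}

end Defs

/-! ## §2  Transport through a window chart: outputs anywhere -/

section Transplant

variable {X X' : Type} [DecidableEq X'] [DecidableEq X] {W : Finset X} {e : X → X'}

end Transplant

/-! ## §3  Transport along a relabelling of the fine lattice and of `𝔅`; the chart translation of the V1 torus -/

section Relabel

variable {g₁ g₂ : B6.Geometry} {X : Type}

end Relabel

section Torus

open B6TranslateV1 (tv)
open B6TranslateTorusV1 (vch TB conj_apply)
open B6TranslateTorusV1L0 (blkV1_translate)
open B6GlobalChartV1 (PV)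
open B6GlobalChartV1L0 (blkV1)
open B6MultiLevelBoxOperator (N0)
open B6MultiLevelTorusOperatorL0 (TDomains)
open B6Geom246MultiLevelTorusL0 (geomT blkMap blkMap_injective)

variable {d ℓ : ℕ} {hd : 1 ≤ d + 1} {hL : Odd (ℓ + 1) ∧ 1 < ℓ + 1} {m K : ℕ} {Mh k R : ℕ} {P' : Fin (d + 1) → ℕ}
variable (hN : ∀ μ, N0 ℓ Mh k P' μ = (PV d ℓ m K hd hL).sitesPerDir 0) (D : TDomains d ℓ Mh k P' R) (hMh : 1 ≤ Mh) (hP : ∀ μ, 1 ≤ P' μ)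
  (s : Fin (d + 1) → ℤ)

include hMh hP in
/-- **INPUT-LOCALISED MAJORANTS IN THE CHART FRAME ARE ONES IN THE GLOBAL FRAME** for the conjugate `τ_{-v} T₂ τ_v` (input set carried by the
block map). [cite: Balaban1984PropagatorsII, (2.133) p.247 + (2.45)–(2.46) p.231, dictionary (charts)] -/
theorem inMajorant_conj_chart {T₂ : Module.End ℝ (PBond (PV d ℓ m K hd hL) 0 → ℝ)} {S : Set (B6Geom246MultiLevelTorusL0.geomT (D.chart s)).Site}
    {K : (geomT (D.chart s)).Site → (geomT (D.chart s)).Site → ℝ} {K' : (geomT D).Site → (geomT D).Site → ℝ}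
    (h₂ : InMajorant (g := geomT (D.chart s)) (blkV1 hN (D.chart s)) T₂ S K)
    (hK : ∀ a b, K a b ≤ K' (blkMap D s a) (blkMap D s b)) :
    InMajorant (g := geomT D) (blkV1 hN D) (TB (-vch Mh k s) * T₂ * TB (vch Mh k s)) (blkMap D s '' S) K' :=
  inMajorant_relabel (g₁ := geomT D) (g₂ := geomT (D.chart s)) (PBond.translateEquiv (vch Mh k s)) (blkMap D s)
    (blkMap_injective hMh hP s) (blkV1 hN D) (blkV1 hN (D.chart s))
    (fun b => blkV1_translate hN D hMh hP s b) (fun f b => conj_apply s T₂ f b)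
    (fun a => ⟨fun ha => by
        obtain ⟨a', ha', he⟩ := (Set.mem_image _ _ _).1 ha
        rwa [← blkMap_injective hMh hP s he], fun ha => Set.mem_image_of_mem _ ha⟩)
    (fun y hy => by
        obtain ⟨a, _, he⟩ := (Set.mem_image _ _ _).1 hy
        exact ⟨a, he⟩) h₂ hK

end Torus

/-! ## §4  The uniform bound of the transplanted `G_□` on the V1 torus for central inputs -/

section Uniform

open B5Eq118OneStroke (iterBlockOf)
open B6Prop25TwoScaleCensus (TSIdx)
open B6Ineq2133TwoScaleV1 (tsGeo onFun ineq2133_G)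
open B6GlobalChartV1 (PV GlV1 toBox)
open B6GlobalChartV1L0 (blkV1)
open B6MultiLevelBoxOperator (N0)
open B6MultiLevelTorusOperatorL0 (TDomains)
open B6Geom246MultiLevelTorusL0 (geomT)
open B4Reflection242 (boxDom)
open B6AgreeLapV1Chart (cB eB DeepB mem_cB_W GlV1_eq eB_eq_chartBond)
open B6Prop26ReachTransplant (chartBond InWindow)
open B6Prop26ReachTransplantL0 (hfib_sites)

variable {d ℓ : ℕ}

/-- **THE UNIFORM INPUT-LOCALISED BOUND OF THE FULL-WINDOW `GlV1`**: for the constant `A` of the two-scale (2.133) majorant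
(`B6Ineq2133TwoScaleV1.ineq2133_G`; on `d, L, a₀, a₁`), every member `t`, V1 global torus (`hN`), corner `x₀ ≥ 0` with the member period inside the
box (`hfit`), `L^j ∣ x₀`, every two-level half-period sub-window `[x₀, x₀ + Wd)` and every input set `S` whose bonds lie in the sub-window:
`|G_□ μ x| ≤ L^{d+1}·A·B` for `μ` over `y′ ∈ S`, `|μ| ≤ B`, and ALL `x` — no decay claimed (none holds at wrap-around outputs).
[cite: Balaban1984PropagatorsII, (2.133) p.247, (2.90)–(2.91) p.239, p.238 (T_□ = □̃³)] -/
theorem inMajorant_GlV1_bdd (d ℓ : ℕ) (hd : 1 ≤ d + 1) (hL : Odd (ℓ + 1) ∧ 1 < ℓ + 1) {a₀ a₁ : ℝ} (ha₀ : 0 < a₀) (ha₁ : a₀ ≤ a₁) :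
    ∃ A : ℝ, 0 ≤ A ∧ ∀ (t : TSIdx d (ℓ + 1) hd hL a₀ a₁) (m K : ℕ) {Mh k R : ℕ} {P' : Fin (d + 1) → ℕ}
      (hN : ∀ μ, N0 ℓ Mh k P' μ = (PV d ℓ m K hd hL).sitesPerDir 0) (D : B6MultiLevelTorusOperatorL0.TDomains d ℓ Mh k P' R)
      (x₀ : Fin (d + 1) → ℤ) (hx₀ : ∀ μ, 0 ≤ x₀ μ) (hfit : ∀ μ, x₀ μ + (t.P.sitesPerDir 0 : ℕ) ≤ ((PV d ℓ m K hd hL).sitesPerDir 0 : ℕ))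
      (_ : ∀ μ, (((ℓ + 1) ^ t.j : ℕ) : ℤ) ∣ x₀ μ) (Wd : ℕ) (_ : Wd ≤ (ℓ + 1) ^ (t.m + t.K))
      (_ : ∀ z ∈ boxDom (N0 ℓ Mh k P'), (∀ μ, x₀ μ ≤ z μ ∧ z μ < x₀ μ + Wd) → t.j ≤ D.lev z ∧ D.lev z ≤ t.j + 1)
      (S : Set (geomT D).Site)
      (_ : ∀ b : PBond (PV d ℓ m K hd hL) 0, blkV1 hN D b ∈ S →
        InWindow (fun b : PBond (PV d ℓ m K hd hL) 0 => (toBox hN b.src : Fin (d + 1) → ℤ)) x₀ Wd b),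
      InMajorant (g := geomT D) (blkV1 hN D) (GlV1 t hN (cB t x₀ hx₀ hfit).W x₀) S
        (fun _ _ => ((ℓ + 1) ^ (d + 1) : ℕ) * A) := by
  obtain ⟨δ, hδ, A, hA, h⟩ := ineq2133_G d (ℓ + 1) hd hL ha₀ ha₁
  refine ⟨A, hA, fun t m K Mh k R P' hN D x₀ hx₀ hfit hdiv Wd hWd hlev S hS => ?_⟩
  classical
  rw [GlV1_eq]
  -- the sub-window of the reach and its fibre count
  let W' : Finset (PBond (PV d ℓ m K hd hL) 0) :=
    (cB t x₀ hx₀ hfit).W.filter fun b => InWindow (fun b : PBond (PV d ℓ m K hd hL) 0 => (toBox hN b.src : Fin (d + 1) → ℤ)) x₀ Wd b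
  have hfib := fun y => hfib_sites t D.toDomains (fun b : PBond (PV d ℓ m K hd hL) 0 => toBox hN b.src) (fun b => b.dir) x₀ hdiv Wd hWd
    hlev W' (fun b hb => (Finset.mem_filter.1 hb).2) y
  refine inMajorant_transplant (g := geomT D) (g' := tsGeo t 0 0) (blkV1 hN D) (fun b : PBond t.P 0 => iterBlockOf t.j b.src) S
    (cB t x₀ hx₀ hfit).inj (h t 0 0) (fun _ _ => A) (fun _ _ => hA) (fun x _ x₁ _ _ => ?_) ((ℓ + 1) ^ (d + 1)) (fun y hy => ?_)
  · -- `A·e^{−δ d} ≤ A`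
    have hnn := t.tdist_nonneg (iterBlockOf t.j ((cB t x₀ hx₀ hfit).e x).src) (iterBlockOf t.j ((cB t x₀ hx₀ hfit).e x₁).src)
    have : Real.exp (-(δ * t.tdist (iterBlockOf t.j ((cB t x₀ hx₀ hfit).e x).src) (iterBlockOf t.j ((cB t x₀ hx₀ hfit).e x₁).src))) ≤ 1 :=
      Real.exp_le_one_iff.2 (by nlinarith)
    nlinarith
  · obtain ⟨T, hTn, hT⟩ := hfib y
    refine ⟨T, hTn, fun x hx hxy => ?_⟩
    have hxw : x ∈ W' := Finset.mem_filter.2 ⟨hx, hS x (hxy ▸ hy)⟩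
    have hx0 : x ∈ DeepB t x₀ 0 := (mem_cB_W (hx₀ := hx₀) (hfit := hfit)).1 hx
    have he : (cB t x₀ hx₀ hfit).e x = chartBond t (fun b : PBond (PV d ℓ m K hd hL) 0 => (toBox hN b.src : Fin (d + 1) → ℤ)) (fun b => b.dir) x₀ x :=
      eB_eq_chartBond hx0
    rw [he]
    exact hT x hxw hxy

end Uniform

end Literature.MathematicalPhysics.QuantumFieldTheory.Balaban1983to89.B6InMajorantTransplantL0
end
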